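import Literature.Probability.RandomPlanarGeometry.SAWFrames
import HarnessLib

/-!
# Attaching an excursion to a self-avoiding walk at the `ℓ¹`-sphere of a free ball: the local
# case analysis (templates)

The energy–entropy surgery of H. Duminil-Copin, G. Kozma, A. Yadin, *Supercritical
self-avoiding walks are space-filling*, Ann. IHP Probab. Stat. 50 (2014), §3 (proof of
Proposition 7) modifies a self-avoiding walk `γ` near an untouched region by a "link" meeting
`γ` "either at just one edge, or at two adjacent edges only … One can easily check that such a
polygon always exists (see figure 2)". For flush boxes such a link does not always exist; the
sorry-free replacement used in this development is the following purely local statement about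
a self-avoiding vertex list `l` (no repetition, consecutive sites adjacent) and a centre `z₀`
such that the open `ℓ¹`-ball of radius `d₀ ≥ 3` about `z₀` contains no vertex of `l` while the
sphere `{|w - z₀|₁ = d₀}` does, the endpoints of `l` being at `ℓ¹`-distance `≥ 10` from each
other:

**`exists_template`**: in one of the eight frames `F` at `z₀` there is a TEMPLATE
(`Template`, shapes `TA, TA2, TA3, TB1, TB2`, anchored at a sphere vertex `g = fr F p q` of
`l`): a stretch `seg = g :: mid ++ [s₂]` of `l` (in either direction; `mid` empty or one
vertex), two distinct sites `i₁ ∼ g` and `i₂` at distance `d₀ - 1` (hence in the free ball) and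
a `tail` (empty or one free sphere site) with `i₂ :: tail ++ [s₂]` a chain — so that replacing
`mid` by `i₁, (any self-avoiding excursion inside the ball from i₁ to i₂), i₂, tail` keeps a
self-avoiding walk (`Template.geom`); OR one of two exceptional configurations `BadB`, `BadX`
in which an ENDPOINT of `l` sits at the sphere in a rigid position (a corner of the sphere left
radially, resp. next to a corner crossed straight), which the applications exclude (endpoints
far away, resp. the geometry of closest boundary sites of the disc). The pair `{i₁, i₂}` is
always an anti-diagonal pair `{fr α (β+1), fr (α+1) β}` (`Template.pair_eq`), from which the
two parallel lanes of the excursion start.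

The proof is the case analysis on the vertex of `l ∩ sphere` maximising the frame ordinate.
-/

noncomputable section

open Finset Literature.Probability.LatticeModels

namespace Literature.Probability.RandomPlanarGeometry.SAW

/-- `fr F a b = fr F a' b'` iff the coordinates agree. [folklore] -/
theorem Frame.fr_eq_fr_iff (F : Frame) {a b a' b' : ℤ} : F.fr a b = F.fr a' b' ↔ a = a' ∧ b = b' :=
  ⟨F.fr_inj, fun h => by rw [h.1, h.2]⟩

/-! ### Templates -/

/-- The five template shapes. [folklore] -/
inductive Shape
  | TA | TA2 | TA3 | TB1 | TB2
  deriving DecidableEq, Fintype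

/-- A template: a frame, the frame coordinates `(p, q)` of the anchor vertex, and a shape.
[cite: DuminilCopinKozmaYadin2014, §3 (proof of Proposition 7: the link ℓ(γ))] -/
structure Template where
  /-- the frame (centre `z₀` and orientation) -/
  F : Frame
  /-- first frame coordinate of the anchor -/
  p : ℤ
  /-- second frame coordinate of the anchor -/
  q : ℤ
  /-- the shape -/
  shape : Shape

namespace Template

variable (T : Template)

/-- The anchor vertex `g = fr p q` (a vertex of the walk on the sphere). [folklore] -/
def g : Site 2 := T.F.fr T.p T.q

/-- The far end of the replaced stretch of the walk. [folklore] -/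
def s₂ : Site 2 :=
  match T.shape with
  | .TA => T.F.fr T.p (T.q + 1)
  | .TA2 => T.F.fr (T.p + 1) (T.q - 1)
  | .TA3 => T.F.fr (T.p + 1) T.q
  | .TB1 => T.F.fr (T.p + 1) T.q
  | .TB2 => T.F.fr (T.p + 1) (T.q - 1)

/-- The vertices of the walk strictly between `g` and `s₂` (dropped by the surgery). [folklore] -/
def mid : List (Site 2) :=
  match T.shape with
  | .TA => []
  | .TA2 => [T.F.fr (T.p + 1) T.q]
  | .TA3 => []
  | .TB1 => []
  | .TB2 => [T.F.fr (T.p + 1) T.q]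

/-- The first free site of the inserted excursion (adjacent to `g`, inside the ball). [folklore] -/
def i₁ : Site 2 :=
  match T.shape with
  | .TA => T.F.fr T.p (T.q - 1)
  | .TA2 => T.F.fr (T.p - 1) T.q
  | .TA3 => T.F.fr (T.p - 1) T.q
  | .TB1 => T.F.fr T.p (T.q - 1)
  | .TB2 => T.F.fr T.p (T.q - 1)

/-- The last free site of the inserted excursion inside the ball. [folklore] -/
def i₂ : Site 2 :=
  match T.shape with
  | .TA => T.F.fr (T.p - 1) T.q
  | .TA2 => T.F.fr T.p (T.q - 1)
  | .TA3 => T.F.fr T.p (T.q - 1)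
  | .TB1 => T.F.fr (T.p + 1) (T.q - 2)
  | .TB2 => T.F.fr (T.p + 1) (T.q - 2)

/-- The free sphere sites between `i₂` and `s₂` (none or one). [folklore] -/
def tail : List (Site 2) :=
  match T.shape with
  | .TA => [T.F.fr (T.p - 1) (T.q + 1)]
  | .TA2 => []
  | .TA3 => [T.F.fr (T.p + 1) (T.q - 1)]
  | .TB1 => [T.F.fr (T.p + 1) (T.q - 1)]
  | .TB2 => []

/-- The stretch of the walk used by the template: `g :: mid ++ [s₂]`. [folklore] -/
def seg : List (Site 2) := T.g :: T.mid ++ [T.s₂]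

/-- The lane abscissa `α`: `{i₁, i₂} = {fr α (β+1), fr (α+1) β}`. [folklore] -/
def α : ℤ :=
  match T.shape with
  | .TA | .TA2 | .TA3 => T.p - 1
  | .TB1 | .TB2 => T.p

/-- The lane ordinate `β`. [folklore] -/
def β : ℤ :=
  match T.shape with
  | .TA | .TA2 | .TA3 => T.q - 1
  | .TB1 | .TB2 => T.q - 2

/-- Well-formedness of a template for the sphere radius `d₀`: the anchor lies on the sphere in
the position required by the shape. [folklore] -/
def WF (d₀ : ℤ) : Prop :=
  match T.shape with
  | .TA | .TA2 | .TA3 => 1 ≤ T.p ∧ 1 ≤ T.q ∧ T.p + T.q = d₀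
  | .TB1 | .TB2 => T.p = 0 ∧ T.q = d₀

/-- The template applies to the walk `l`: the stretch occurs in `l` (in either direction) and
the tail sites are not on `l`. [cite: DuminilCopinKozmaYadin2014, §3 (proof of Proposition 7: ℓ(γ) meets γ in one edge or two adjacent edges)] -/
def Holds (l : List (Site 2)) : Prop :=
  (T.seg <:+: l ∨ T.seg.reverse <:+: l) ∧ ∀ w ∈ T.tail, w ∉ l

/-- **Geometry of a well-formed template**: `i₁ ∼ g`; `i₂ :: tail ++ [s₂]` is a chain; `i₁ ≠ i₂`
lie at `ℓ¹`-distance `d₀ - 1` from the centre, the tail at distance `d₀`, `g` at distance `d₀`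
and `s₂` and `mid` at distance `≥ d₀`. [folklore] -/
theorem geom {d₀ : ℤ} (hd : 3 ≤ d₀) (h : T.WF d₀) :
    (zdGraph 2).Adj T.g T.i₁ ∧ (T.i₂ :: T.tail ++ [T.s₂]).IsChain (zdGraph 2).Adj ∧ T.i₁ ≠ T.i₂ ∧
      l1dist T.i₁ T.F.z₀ = d₀ - 1 ∧ l1dist T.i₂ T.F.z₀ = d₀ - 1 ∧
      (∀ w ∈ T.tail, l1dist w T.F.z₀ = d₀) ∧ l1dist T.g T.F.z₀ = d₀ ∧ d₀ ≤ l1dist T.s₂ T.F.z₀ ∧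
      (∀ w ∈ T.mid, d₀ ≤ l1dist w T.F.z₀) ∧ T.tail.length ≤ 1 ∧ T.mid.length ≤ 1 := by
  have a1 := abs_cases T.p; have a2 := abs_cases (T.p - 1); have a3 := abs_cases (T.p + 1)
  have a4 := abs_cases T.q; have a5 := abs_cases (T.q - 1); have a6 := abs_cases (T.q + 1)
  have a7 := abs_cases (T.q - 2)
  refine ⟨?_, ?_, ?_, ?_, ?_, ?_, ?_, ?_, ?_, ?_, ?_⟩
  · cases hs : T.shape <;> simp only [WF, hs] at h <;> simp only [g, i₁, hs] <;>
      rw [Frame.adj_fr_iff] <;> omega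
  · cases hs : T.shape <;> simp only [WF, hs] at h <;>
      simp only [i₂, tail, s₂, hs, List.cons_append, List.nil_append, List.isChain_cons_cons,
        List.isChain_singleton, and_true] <;> (repeat rw [Frame.adj_fr_iff]) <;> omega
  · intro heq
    cases hs : T.shape <;> simp only [WF, hs] at h <;> simp only [i₁, i₂, hs] at heq <;>
      have := T.F.fr_inj heq <;> omega
  · cases hs : T.shape <;> simp only [WF, hs] at h <;> simp only [i₁, hs, Frame.l1dist_fr] <;> omega
  · cases hs : T.shape <;> simp only [WF, hs] at h <;> simp only [i₂, hs, Frame.l1dist_fr] <;> omega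
  · cases hs : T.shape <;> simp only [WF, hs] at h <;>
      simp only [tail, hs, List.mem_singleton, forall_eq, List.not_mem_nil, false_imp_iff,
        imp_true_iff, Frame.l1dist_fr] <;> omega
  · cases hs : T.shape <;> simp only [WF, hs] at h <;> simp only [g, Frame.l1dist_fr] <;> omega
  · cases hs : T.shape <;> simp only [WF, hs] at h <;> simp only [s₂, hs, Frame.l1dist_fr] <;> omega
  · cases hs : T.shape <;> simp only [WF, hs] at h <;>
      simp only [mid, hs, List.mem_singleton, forall_eq, List.not_mem_nil, false_imp_iff,
        imp_true_iff, Frame.l1dist_fr] <;> omega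
  · cases hs : T.shape <;> simp [tail, hs]
  · cases hs : T.shape <;> simp [mid, hs]

/-- The two ball sites of a template form the anti-diagonal pair over `(α, β)`. [folklore] -/
theorem pair_eq : (T.i₁ = T.F.fr T.α (T.β + 1) ∧ T.i₂ = T.F.fr (T.α + 1) T.β) ∨
    (T.i₁ = T.F.fr (T.α + 1) T.β ∧ T.i₂ = T.F.fr T.α (T.β + 1)) := by
  cases hs : T.shape <;> simp only [i₁, i₂, α, β, hs]
  · exact Or.inr ⟨by rw [Frame.fr_eq_fr_iff]; omega, by rw [Frame.fr_eq_fr_iff]; omega⟩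
  · exact Or.inl ⟨by rw [Frame.fr_eq_fr_iff]; omega, by rw [Frame.fr_eq_fr_iff]; omega⟩
  · exact Or.inl ⟨by rw [Frame.fr_eq_fr_iff]; omega, by rw [Frame.fr_eq_fr_iff]; omega⟩
  · exact Or.inl ⟨by rw [Frame.fr_eq_fr_iff]; omega, trivial⟩
  · exact Or.inl ⟨by rw [Frame.fr_eq_fr_iff]; omega, trivial⟩

/-- The lane data of a well-formed template: `α ≥ 0` and `α + β = d₀ - 2`. [folklore] -/
theorem α_add_β {d₀ : ℤ} (h : T.WF d₀) : 0 ≤ T.α ∧ T.α + T.β = d₀ - 2 := by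
  cases hs : T.shape <;> simp only [WF, hs] at h <;> simp only [α, β, hs] <;> omega

end Template

/-! ### The exceptional configurations -/

/-- Exceptional configuration B: the corner `fr 0 d₀` of the sphere is an ENDPOINT of the walk,
which leaves it radially (through `fr 0 (d₀+1)`). [folklore] -/
def BadB (F : Frame) (d₀ : ℤ) (l : List (Site 2)) : Prop :=
  IsEnd l (F.fr 0 d₀) ∧ F.fr 0 (d₀ + 1) ∈ l

/-- Exceptional configuration X: the walk crosses the corner `fr 0 d₀` straight (from `fr 1 d₀`
to `fr 0 (d₀+1)`), and the site `fr 1 (d₀-1)` diagonally inside is an ENDPOINT of the walk.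
[folklore] -/
def BadX (F : Frame) (d₀ : ℤ) (l : List (Site 2)) : Prop :=
  F.fr 0 d₀ ∈ l ∧ F.fr 1 d₀ ∈ l ∧ F.fr 0 (d₀ + 1) ∈ l ∧ IsEnd l (F.fr 1 (d₀ - 1))

/-! ### Distances in frame coordinates -/

/-- `ℓ¹`-distance is symmetric. [folklore] -/
theorem l1dist_comm (a b : Site 2) : l1dist a b = l1dist b a := by
  simp only [l1dist, abs_sub_comm]

/-- `ℓ¹`-distance of two sites in frame coordinates (frames are isometries). [folklore] -/
theorem Frame.l1dist_fr_fr (F : Frame) (a b a' b' : ℤ) :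
    l1dist (F.fr a b) (F.fr a' b') = |a - a'| + |b - b'| := by
  have h0 : F.fr a b 0 - F.fr a' b' 0 = (a - a') * F.ex 0 + (b - b') * F.ey 0 := by
    simp only [Frame.fr_apply]; ring
  have h1 : F.fr a b 1 - F.fr a' b' 1 = (a - a') * F.ex 1 + (b - b') * F.ey 1 := by
    simp only [Frame.fr_apply]; ring
  simp only [l1dist, h0, h1]
  rcases F.valid with ⟨e1, e2 | e2⟩ | ⟨e1, e2 | e2⟩ | ⟨e1, e2 | e2⟩ | ⟨e1, e2 | e2⟩ <;>
    simp only [e1, e2, pt_apply_zero, pt_apply_one, mul_one, mul_zero, add_zero, mul_neg, abs_neg,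
      add_comm]

/-! ### Local structure of the walk at a sphere vertex -/

section Local

variable {l : List (Site 2)} (hl : l.Nodup) (hc : l.IsChain (zdGraph 2).Adj) {u v : Site 2}
  (hu : l.head? = some u) (hv : l.getLast? = some v) (huv : 10 ≤ l1dist u v) (F : Frame) {d₀ : ℤ}
  (hd : 3 ≤ d₀) (hfree : ∀ w ∈ l, d₀ ≤ l1dist w F.z₀)

include hc hfree in
/-- A list-neighbour of a vertex is an adjacent site of the walk, hence outside the open ball:
its frame coordinates differ by a unit step and have `ℓ¹`-norm `≥ d₀`. [folklore] -/
theorem listNbr_coords {w c : Site 2} (h : ListNbr l w c) :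
    (((F.fx c = F.fx w + 1 ∨ F.fx w = F.fx c + 1) ∧ F.fy c = F.fy w) ∨
      ((F.fy c = F.fy w + 1 ∨ F.fy w = F.fy c + 1) ∧ F.fx c = F.fx w)) ∧
      d₀ ≤ |F.fx c| + |F.fy c| := by
  refine ⟨(F.adj_iff_frame w c).1 (h.rel (fun x y hxy => hxy.symm) hc), ?_⟩
  rw [← F.l1dist_eq_frame]
  exact hfree c h.mem

include hfree in
/-- Sites strictly inside the ball are not on the walk. [folklore] -/
theorem not_mem_of_lt {a b : ℤ} (hab : |a| + |b| < d₀) : F.fr a b ∉ l := fun h => by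
  have := hfree _ h
  rw [F.l1dist_fr] at this
  omega

include hu hv huv in
/-- Two distinct endpoints of the walk are its two ends, hence far apart. [folklore] -/
theorem le_l1dist_of_isEnd {a b : Site 2} (ha : IsEnd l a) (hb : IsEnd l b) (hab : a ≠ b) :
    10 ≤ l1dist a b := by
  rcases ha.eq_or_eq hu hv with rfl | rfl <;> rcases hb.eq_or_eq hu hv with rfl | rfl
  · exact absurd rfl hab
  · exact huv
  · rw [l1dist_comm]; exact huv
  · exact absurd rfl hab

include hu hv huv in
/-- The walk has at least two vertices. [folklore] -/
theorem two_le_length : 2 ≤ l.length := by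
  rcases l with _ | ⟨x, _ | ⟨y, rest⟩⟩
  · simp at hu
  · simp only [List.head?_cons, Option.some.injEq, List.getLast?_singleton] at hu hv
    subst hu; subst hv
    simp [l1dist] at huv
  · simp

include hl hc hd hfree in
/-- **The east side of a corner.** If the corner `g = fr 0 d₀` of the sphere has the list-neighbour
`E = fr 1 d₀`, then template `TB1` or `TB2` applies in the frame, unless the site `fr 1 (d₀-1)`
is an endpoint of the walk. [folklore] -/
theorem sideE (hE : ListNbr l (F.fr 0 d₀) (F.fr 1 d₀)) :
    (∃ T : Template, T.F.z₀ = F.z₀ ∧ T.WF d₀ ∧ T.Holds l) ∨ IsEnd l (F.fr 1 (d₀ - 1)) := by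
  by_cases hD : F.fr 1 (d₀ - 1) ∈ l
  · -- the list-neighbours of `D` are `fr 2 (d₀-1)` or `E`
    by_cases hDE : ListNbr l (F.fr 1 (d₀ - 1)) (F.fr 1 d₀)
    · -- `E` has the two list-neighbours `g` and `D`: consecutive triple, template TB2
      have hne : F.fr 0 d₀ ≠ F.fr 1 (d₀ - 1) := fun h => by have := F.fr_inj h; omega
      rcases infix_triple_of_listNbr hl hE.symm hDE.symm hne with htri | htri
      · refine Or.inl ⟨⟨F, 0, d₀, .TB2⟩, rfl, ⟨rfl, rfl⟩, Or.inl ?_, by simp [Template.tail]⟩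
        simpa [Template.seg, Template.g, Template.mid, Template.s₂] using htri
      · refine Or.inl ⟨⟨F, 0, d₀, .TB2⟩, rfl, ⟨rfl, rfl⟩, Or.inr ?_, by simp [Template.tail]⟩
        simpa [Template.seg, Template.g, Template.mid, Template.s₂] using htri
    · -- every list-neighbour of `D` is `fr 2 (d₀ - 1)`: `D` is an endpoint
      refine Or.inr (isEnd_of_listNbr_subset_singleton hl hD (F.fr 2 (d₀ - 1)) fun a ha => ?_)
      have hcoord := listNbr_coords hc F hfree ha
      simp only [Frame.fx_fr, Frame.fy_fr] at hcoord
      have ha1 := abs_cases (F.fx a); have ha2 := abs_cases (F.fy a)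
      rw [F.eq_fr_iff]
      rcases hcoord with ⟨⟨h1 | h1, h2⟩ | ⟨h2 | h2, h1⟩, hge⟩
      · omega
      · omega
      · exfalso; apply hDE
        have : a = F.fr 1 d₀ := by rw [F.eq_fr_iff]; omega
        rwa [this] at ha
      · omega
  · -- template TB1
    refine Or.inl ⟨⟨F, 0, d₀, .TB1⟩, rfl, ⟨rfl, rfl⟩, ?_, ?_⟩
    · rcases hE with h | h
      · right; simpa [Template.seg, Template.g, Template.mid, Template.s₂] using h
      · left; simpa [Template.seg, Template.g, Template.mid, Template.s₂] using h
    · simpa [Template.tail] using hD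

include hc hd hfree in
/-- The list-neighbours of the corner `fr 0 d₀` are among `fr 1 d₀`, `fr (-1) d₀`, `fr 0 (d₀+1)`.
[folklore] -/
theorem listNbr_corner {c : Site 2} (h : ListNbr l (F.fr 0 d₀) c) :
    c = F.fr 1 d₀ ∨ c = F.fr (-1) d₀ ∨ c = F.fr 0 (d₀ + 1) := by
  have hcoord := listNbr_coords hc F hfree h
  simp only [Frame.fx_fr, Frame.fy_fr] at hcoord
  have ha1 := abs_cases (F.fx c); have ha2 := abs_cases (F.fy c)
  rw [F.eq_fr_iff, F.eq_fr_iff, F.eq_fr_iff]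
  omega

include hl hc hu hv huv hd hfree in
/-- **The corner case, oriented.** If the corner `g = fr 0 d₀` is a vertex of the walk with
list-neighbour `E = fr 1 d₀`, a template applies (in `F` or its mirror) or the configuration
is the exceptional `BadX` of `F`. [folklore] -/
theorem caseB_oriented (hE : ListNbr l (F.fr 0 d₀) (F.fr 1 d₀)) :
    (∃ T : Template, T.F.z₀ = F.z₀ ∧ T.WF d₀ ∧ T.Holds l) ∨ BadX F d₀ l := by
  rcases sideE hl hc F hd hfree hE with hT | hD
  · exact Or.inl hT
  -- `D = fr 1 (d₀-1)` is an endpoint; then `g` is interior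
  have hg : F.fr 0 d₀ ∈ l := hE.mem_left
  have hgint : ¬IsEnd l (F.fr 0 d₀) := fun hgend => by
    have := le_l1dist_of_isEnd hu hv huv hgend hD (fun h => by have := F.fr_inj h; omega)
    rw [F.l1dist_fr_fr] at this
    have a1 := abs_cases (0 - 1 : ℤ); have a2 := abs_cases (d₀ - (d₀ - 1))
    omega
  obtain ⟨a, b, htri, hab, hall⟩ := exists_pred_succ hl hg hgint
  obtain ⟨s, t, hst⟩ := htri
  have ha : ListNbr l (F.fr 0 d₀) a := Or.inl ⟨s, b :: t, by rw [← hst]; simp⟩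
  have hb : ListNbr l (F.fr 0 d₀) b := Or.inr ⟨s ++ [a], t, by rw [← hst]; simp⟩
  -- the other list-neighbour `c ≠ E` of `g`
  obtain ⟨c, hc', hcE⟩ : ∃ c, ListNbr l (F.fr 0 d₀) c ∧ c ≠ F.fr 1 d₀ := by
    by_cases haE : a = F.fr 1 d₀
    · exact ⟨b, hb, fun h => hab (haE.trans h.symm)⟩
    · exact ⟨a, ha, haE⟩
  rcases listNbr_corner hc F hd hfree hc' with rfl | rfl | rfl
  · exact absurd rfl hcE
  · -- the other neighbour is `W`: the east side of the mirrored frame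
    have hW : ListNbr l (F.mirror.fr 0 d₀) (F.mirror.fr 1 d₀) := by simpa using hc'
    have hfree' : ∀ w ∈ l, d₀ ≤ l1dist w F.mirror.z₀ := hfree
    rcases sideE hl hc F.mirror hd hfree' hW with hT | hD'
    · exact Or.inl hT
    · exfalso
      have hne : F.fr 1 (d₀ - 1) ≠ F.mirror.fr 1 (d₀ - 1) := fun h => by
        rw [Frame.mirror_fr] at h; have := F.fr_inj h; omega
      have := le_l1dist_of_isEnd hu hv huv hD hD' hne
      rw [Frame.mirror_fr, F.l1dist_fr_fr] at this
      have a1 := abs_cases (1 - -1 : ℤ); have a2 := abs_cases (d₀ - 1 - (d₀ - 1))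
      omega
  · -- the other neighbour is `N`: configuration `BadX`
    exact Or.inr ⟨hg, hE.mem, hc'.mem, hD⟩

include hl hc hu hv huv hd hfree in
/-- **The corner case.** If the corner `fr 0 d₀` of the sphere is a vertex of the walk, then a
template applies, or one of the exceptional configurations occurs, in some frame at the same
centre. [folklore] -/
theorem caseB (hg : F.fr 0 d₀ ∈ l) :
    (∃ T : Template, T.F.z₀ = F.z₀ ∧ T.WF d₀ ∧ T.Holds l) ∨
      (∃ G : Frame, G.z₀ = F.z₀ ∧ BadB G d₀ l) ∨ (∃ G : Frame, G.z₀ = F.z₀ ∧ BadX G d₀ l) := by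
  by_cases hE : ListNbr l (F.fr 0 d₀) (F.fr 1 d₀)
  · rcases caseB_oriented hl hc hu hv huv F hd hfree hE with hT | hX
    · exact Or.inl hT
    · exact Or.inr (Or.inr ⟨F, rfl, hX⟩)
  by_cases hW : ListNbr l (F.fr 0 d₀) (F.fr (-1) d₀)
  · have hW' : ListNbr l (F.mirror.fr 0 d₀) (F.mirror.fr 1 d₀) := by simpa using hW
    have hfree' : ∀ w ∈ l, d₀ ≤ l1dist w F.mirror.z₀ := hfree
    rcases caseB_oriented hl hc hu hv huv F.mirror hd hfree' hW' with hT | hX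
    · exact Or.inl hT
    · exact Or.inr (Or.inr ⟨F.mirror, rfl, hX⟩)
  -- all list-neighbours are `N`: `g` is an endpoint leaving radially
  have hN : ∀ c, ListNbr l (F.fr 0 d₀) c → c = F.fr 0 (d₀ + 1) := fun c hc' => by
    rcases listNbr_corner hc F hd hfree hc' with rfl | rfl | rfl
    · exact absurd hc' hE
    · exact absurd hc' hW
    · rfl
  have hend := isEnd_of_listNbr_subset_singleton hl hg _ hN
  obtain ⟨c, hc'⟩ := exists_listNbr (two_le_length hu hv huv) hg
  have hcN := hN c hc'
  subst hcN
  exact Or.inr (Or.inl ⟨F, rfl, hend, hc'.mem⟩)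

include hl hc hu hv huv hd hfree in
/-- **The generic case.** If `g = fr p q` with `p, q ≥ 1` is a vertex of the walk on the sphere of
maximal ordinate among the sphere vertices of the walk, a template applies (shapes `TA`, `TA2`,
`TA3` in `F`, or `TB1`, `TB2` in the rotated frame). [folklore] -/
theorem caseA {p q : ℤ} (hp : 1 ≤ p) (hq : 1 ≤ q) (hpq : p + q = d₀) (hg : F.fr p q ∈ l)
    (hmax : ∀ w ∈ l, l1dist w F.z₀ = d₀ → F.fy w ≤ q) :
    ∃ T : Template, T.F.z₀ = F.z₀ ∧ T.WF d₀ ∧ T.Holds l := by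
  -- the list-neighbours of `g` are `A = fr (p+1) q` or `B = fr p (q+1)`
  have hnbr : ∀ c, ListNbr l (F.fr p q) c → c = F.fr (p + 1) q ∨ c = F.fr p (q + 1) := by
    intro c hc'
    have hcoord := listNbr_coords hc F hfree hc'
    simp only [Frame.fx_fr, Frame.fy_fr] at hcoord
    have ha1 := abs_cases (F.fx c); have ha2 := abs_cases (F.fy c)
    rw [F.eq_fr_iff, F.eq_fr_iff]
    omega
  -- `B* = fr (p-1) (q+1)` is not on the walk (it would have a larger ordinate on the sphere)
  have hBstar : F.fr (p - 1) (q + 1) ∉ l := fun h => by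
    have := hmax _ h (by rw [F.l1dist_fr]; have := abs_cases (p - 1); have := abs_cases (q + 1); omega)
    rw [F.fy_fr] at this
    omega
  by_cases hB : ListNbr l (F.fr p q) (F.fr p (q + 1))
  · -- template TA
    refine ⟨⟨F, p, q, .TA⟩, rfl, ⟨hp, hq, hpq⟩, ?_, by simpa [Template.tail] using hBstar⟩
    rcases hB with h | h
    · right; simpa [Template.seg, Template.g, Template.mid, Template.s₂] using h
    · left; simpa [Template.seg, Template.g, Template.mid, Template.s₂] using h
  -- otherwise `g` is an endpoint with the single list-neighbour `A`
  have hAonly : ∀ c, ListNbr l (F.fr p q) c → c = F.fr (p + 1) q := fun c hc' => by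
    rcases hnbr c hc' with h | h
    · exact h
    · exact absurd (h ▸ hc') hB
  have hgend : IsEnd l (F.fr p q) := isEnd_of_listNbr_subset_singleton hl hg _ hAonly
  obtain ⟨c, hc'⟩ := exists_listNbr (two_le_length hu hv huv) hg
  have hcA := hAonly c hc'
  subst hcA
  have hA : F.fr (p + 1) q ∈ l := hc'.mem
  -- `A` is interior
  have hAint : ¬IsEnd l (F.fr (p + 1) q) := fun hAend => by
    have := le_l1dist_of_isEnd hu hv huv hgend hAend (fun h => by have := F.fr_inj h; omega)
    rw [F.l1dist_fr_fr] at this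
    have a1 := abs_cases (p - (p + 1)); have a2 := abs_cases (q - q)
    omega
  obtain ⟨a, b, htri, hab, hall⟩ := exists_pred_succ hl hA hAint
  obtain ⟨s, t, hst⟩ := htri
  have ha : ListNbr l (F.fr (p + 1) q) a := Or.inl ⟨s, b :: t, by rw [← hst]; simp⟩
  have hb : ListNbr l (F.fr (p + 1) q) b := Or.inr ⟨s ++ [a], t, by rw [← hst]; simp⟩
  -- the list-neighbour `nxt ≠ g` of `A`
  obtain ⟨nxt, hnxt, hnxtg⟩ : ∃ nxt, ListNbr l (F.fr (p + 1) q) nxt ∧ nxt ≠ F.fr p q := by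
    by_cases hag : a = F.fr p q
    · exact ⟨b, hb, fun h => hab (hag.trans h.symm)⟩
    · exact ⟨a, ha, hag⟩
  have hAg : ListNbr l (F.fr (p + 1) q) (F.fr p q) := hc'.symm
  -- any list-neighbour of `A` other than `g` and `nxt` is impossible
  have hAall : ∀ c, ListNbr l (F.fr (p + 1) q) c → c = F.fr p q ∨ c = nxt := fun c hc'' =>
    ListNbr.eq_or_eq hl hAg hnxt hnxtg.symm hc''
  by_cases hnA : nxt = F.fr (p + 1) (q - 1)
  · -- template TA2: the triple `g, A, A*`
    subst hnA
    rcases infix_triple_of_listNbr hl hAg hnxt hnxtg.symm with htri' | htri'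
    · refine ⟨⟨F, p, q, .TA2⟩, rfl, ⟨hp, hq, hpq⟩, Or.inl ?_, by simp [Template.tail]⟩
      simpa [Template.seg, Template.g, Template.mid, Template.s₂] using htri'
    · refine ⟨⟨F, p, q, .TA2⟩, rfl, ⟨hp, hq, hpq⟩, Or.inr ?_, by simp [Template.tail]⟩
      simpa [Template.seg, Template.g, Template.mid, Template.s₂] using htri'
  by_cases hAstar : F.fr (p + 1) (q - 1) ∈ l
  · -- `A* ∈ l`: its list-neighbours
    have hAstarA : ¬ListNbr l (F.fr (p + 1) (q - 1)) (F.fr (p + 1) q) := fun h => by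
      rcases hAall _ h.symm with h' | h'
      · have := F.fr_inj h'; omega
      · exact hnA h'.symm
    by_cases hq1 : q = 1
    · -- `q = 1`: `A* = fr d₀ 0` is a corner of the sphere, interior, with the lateral
      -- list-neighbour `fr d₀ (-1)`: the east side of the rotated frame
      subst hq1
      have hAsint : ¬IsEnd l (F.fr (p + 1) (1 - 1)) := fun hAsend => by
        have := le_l1dist_of_isEnd hu hv huv hgend hAsend (fun h => by have := F.fr_inj h; omega)
        rw [F.l1dist_fr_fr] at this
        have a1 := abs_cases (p - (p + 1)); have a2 := abs_cases (1 - (1 - 1) : ℤ)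
        omega
      obtain ⟨a', b', htri'', hab', hall'⟩ := exists_pred_succ hl hAstar hAsint
      obtain ⟨s', t', hst'⟩ := htri''
      have ha' : ListNbr l (F.fr (p + 1) (1 - 1)) a' := Or.inl ⟨s', b' :: t', by rw [← hst']; simp⟩
      have hb' : ListNbr l (F.fr (p + 1) (1 - 1)) b' := Or.inr ⟨s' ++ [a'], t', by rw [← hst']; simp⟩
      have hside : ∀ c, ListNbr l (F.fr (p + 1) (1 - 1)) c →
          c = F.fr (p + 2) 0 ∨ c = F.fr (p + 1) (-1) := fun c hc'' => by
        have hcoord := listNbr_coords hc F hfree hc''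
        simp only [Frame.fx_fr, Frame.fy_fr] at hcoord
        have ha1 := abs_cases (F.fx c); have ha2 := abs_cases (F.fy c)
        rw [F.eq_fr_iff, F.eq_fr_iff]
        rcases hcoord with ⟨⟨h1 | h1, h2⟩ | ⟨h2 | h2, h1⟩, hge⟩
        · left; omega
        · omega
        · exfalso; apply hAstarA
          have : c = F.fr (p + 1) 1 := by rw [F.eq_fr_iff]; omega
          rwa [this] at hc''
        · right; omega
      have hlat : ListNbr l (F.fr (p + 1) (1 - 1)) (F.fr (p + 1) (-1)) := by
        rcases hside a' ha' with h | h
        · rcases hside b' hb' with h' | h'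
          · exact absurd (h.trans h'.symm) hab'
          · rwa [h'] at hb'
        · rwa [h] at ha'
      -- in the rotated frame `G = F.rotL`: `A* = G.fr 0 d₀`, the lateral neighbour is `G.fr 1 d₀`
      have hG : ListNbr l (F.rotL.fr 0 (p + 1)) (F.rotL.fr 1 (p + 1)) := by
        simpa [Frame.rotL_fr] using hlat
      have hfree' : ∀ w ∈ l, p + 1 ≤ l1dist w F.rotL.z₀ := by
        intro w hw; have := hfree w hw; rw [Frame.rotL_z₀]; omega
      rcases sideE hl hc F.rotL (d₀ := p + 1) (by omega) hfree' hG with hT | hD'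
      · obtain ⟨T, hT1, hT2, hT3⟩ := hT
        exact ⟨T, hT1, by rwa [← hpq], hT3⟩
      · exfalso
        have hne : F.fr p 1 ≠ F.rotL.fr 1 (p + 1 - 1) := fun h => by
          rw [Frame.rotL_fr] at h; have := F.fr_inj h; omega
        have := le_l1dist_of_isEnd hu hv huv hgend hD' hne
        rw [Frame.rotL_fr, F.l1dist_fr_fr] at this
        have a1 := abs_cases (p - (p + 1 - 1)); have a2 := abs_cases (1 - -1 : ℤ)
        omega
    · -- `q ≥ 2`: `A*` would be an endpoint next to the endpoint `g`
      exfalso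
      have hAsend : IsEnd l (F.fr (p + 1) (q - 1)) := by
        refine isEnd_of_listNbr_subset_singleton hl hAstar (F.fr (p + 2) (q - 1)) fun c hc'' => ?_
        have hcoord := listNbr_coords hc F hfree hc''
        simp only [Frame.fx_fr, Frame.fy_fr] at hcoord
        have ha1 := abs_cases (F.fx c); have ha2 := abs_cases (F.fy c)
        rw [F.eq_fr_iff]
        rcases hcoord with ⟨⟨h1 | h1, h2⟩ | ⟨h2 | h2, h1⟩, hge⟩
        · omega
        · omega
        · exfalso; apply hAstarA
          have : c = F.fr (p + 1) q := by rw [F.eq_fr_iff]; omega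
          rwa [this] at hc''
        · omega
      have := le_l1dist_of_isEnd hu hv huv hgend hAsend (fun h => by have := F.fr_inj h; omega)
      rw [F.l1dist_fr_fr] at this
      have a1 := abs_cases (p - (p + 1)); have a2 := abs_cases (q - (q - 1))
      omega
  · -- template TA3
    refine ⟨⟨F, p, q, .TA3⟩, rfl, ⟨hp, hq, hpq⟩, ?_, by simpa [Template.tail] using hAstar⟩
    rcases hAg with h | h
    · left; simpa [Template.seg, Template.g, Template.mid, Template.s₂] using h
    · right; simpa [Template.seg, Template.g, Template.mid, Template.s₂] using h

end Local

/-! ### The cover theorem -/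

/-- Transport of the conclusion along frames with the same centre. [folklore] -/
theorem conclusion_of_frame {l : List (Site 2)} {d₀ : ℤ} {z₀ : Site 2} (G : Frame) (hG : G.z₀ = z₀)
    (h : (∃ T : Template, T.F.z₀ = G.z₀ ∧ T.WF d₀ ∧ T.Holds l) ∨
      (∃ G' : Frame, G'.z₀ = G.z₀ ∧ BadB G' d₀ l) ∨ (∃ G' : Frame, G'.z₀ = G.z₀ ∧ BadX G' d₀ l)) :
    (∃ T : Template, T.F.z₀ = z₀ ∧ T.WF d₀ ∧ T.Holds l) ∨
      (∃ G' : Frame, G'.z₀ = z₀ ∧ BadB G' d₀ l) ∨ (∃ G' : Frame, G'.z₀ = z₀ ∧ BadX G' d₀ l) := by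
  rwa [hG] at h

/-- **The cover theorem.** Around a centre `z₀` whose open `ℓ¹`-ball of radius `d₀ ≥ 3` is free
of the self-avoiding walk `l` while the sphere is not, and whose endpoints are at `ℓ¹`-distance
`≥ 10` from each other, one of the five templates applies in some frame at `z₀`, or one of the
two exceptional endpoint configurations occurs. This is the sorry-free replacement for "One
can easily check that such a polygon always exists (see figure 2)".
[cite: DuminilCopinKozmaYadin2014, §3 (proof of Proposition 7: existence of the link ℓ(γ))] -/
theorem exists_template {l : List (Site 2)} (hl : l.Nodup) (hc : l.IsChain (zdGraph 2).Adj)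
    {u v : Site 2} (hu : l.head? = some u) (hv : l.getLast? = some v) (huv : 10 ≤ l1dist u v)
    (z₀ : Site 2) {d₀ : ℤ} (hd : 3 ≤ d₀) (hfree : ∀ w ∈ l, d₀ ≤ l1dist w z₀)
    (hΓ : ∃ g ∈ l, l1dist g z₀ = d₀) :
    (∃ T : Template, T.F.z₀ = z₀ ∧ T.WF d₀ ∧ T.Holds l) ∨
      (∃ G : Frame, G.z₀ = z₀ ∧ BadB G d₀ l) ∨ (∃ G : Frame, G.z₀ = z₀ ∧ BadX G d₀ l) := by
  classical
  set F₀ := Frame.std z₀ with hF₀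
  have hz : F₀.z₀ = z₀ := rfl
  set Γ : Finset (Site 2) := l.toFinset.filter fun w => l1dist w z₀ = d₀ with hΓdef
  have hmemΓ : ∀ {w}, w ∈ Γ ↔ w ∈ l ∧ l1dist w z₀ = d₀ := by
    intro w; rw [hΓdef, Finset.mem_filter, List.mem_toFinset]
  have hΓne : Γ.Nonempty := by
    obtain ⟨g, hg, hgd⟩ := hΓ
    exact ⟨g, hmemΓ.2 ⟨hg, hgd⟩⟩
  -- frame-coordinate form of the sphere condition
  have hsph : ∀ {w}, w ∈ Γ → |F₀.fx w| + |F₀.fy w| = d₀ := fun hw => by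
    rw [← F₀.l1dist_eq_frame, hz]; exact (hmemΓ.1 hw).2
  obtain ⟨g₁, hg₁, hmax₁⟩ := Finset.exists_max_image Γ (fun w => F₀.fy w) hΓne
  have hg₁l : g₁ ∈ l := (hmemΓ.1 hg₁).1
  have hg₁s := hsph hg₁
  have a1 := abs_cases (F₀.fx g₁); have a2 := abs_cases (F₀.fy g₁)
  by_cases h1 : 1 ≤ F₀.fy g₁
  · -- the maximal ordinate is positive
    have hmax : ∀ w ∈ l, l1dist w z₀ = d₀ → F₀.fy w ≤ F₀.fy g₁ := fun w hw hwd =>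
      hmax₁ w (hmemΓ.2 ⟨hw, hwd⟩)
    rcases lt_trichotomy (F₀.fx g₁) 0 with hx | hx | hx
    · -- west half: mirrored frame
      have hg : F₀.mirror.fr (-F₀.fx g₁) (F₀.fy g₁) ∈ l := by
        rw [Frame.mirror_fr, neg_neg, F₀.fr_fx_fy]; exact hg₁l
      obtain ⟨T, hT1, hT2, hT3⟩ := caseA hl hc hu hv huv F₀.mirror hd hfree (by omega) h1 (by omega) hg
        (fun w hw hwd => by rw [Frame.fy_mirror]; exact hmax w hw hwd)
      exact Or.inl ⟨T, hT1, hT2, hT3⟩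
    · -- the corner `fr 0 d₀`
      have hg : F₀.fr 0 d₀ ∈ l := by
        have : g₁ = F₀.fr 0 d₀ := by rw [F₀.eq_fr_iff]; omega
        rw [← this]; exact hg₁l
      exact conclusion_of_frame F₀ hz (caseB hl hc hu hv huv F₀ hd hfree hg)
    · -- east half
      have hg : F₀.fr (F₀.fx g₁) (F₀.fy g₁) ∈ l := by rw [F₀.fr_fx_fy]; exact hg₁l
      obtain ⟨T, hT1, hT2, hT3⟩ := caseA hl hc hu hv huv F₀ hd hfree (by omega) h1 (by omega) hg hmax
      exact Or.inl ⟨T, hT1, hT2, hT3⟩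
  · -- all ordinates are `≤ 0`; look at the minimal one
    obtain ⟨g₂, hg₂, hmin₂⟩ := Finset.exists_min_image Γ (fun w => F₀.fy w) hΓne
    have hg₂l : g₂ ∈ l := (hmemΓ.1 hg₂).1
    have hg₂s := hsph hg₂
    have b1 := abs_cases (F₀.fx g₂); have b2 := abs_cases (F₀.fy g₂)
    by_cases h2 : F₀.fy g₂ ≤ -1
    · have hmax : ∀ w ∈ l, l1dist w z₀ = d₀ → F₀.flipY.fy w ≤ -F₀.fy g₂ := fun w hw hwd => by
        rw [Frame.fy_flipY, neg_le_neg_iff]; exact hmin₂ w (hmemΓ.2 ⟨hw, hwd⟩)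
      have hfree' : ∀ w ∈ l, d₀ ≤ l1dist w F₀.flipY.z₀ := hfree
      rcases lt_trichotomy (F₀.fx g₂) 0 with hx | hx | hx
      · have hg : F₀.flipY.mirror.fr (-F₀.fx g₂) (-F₀.fy g₂) ∈ l := by
          rw [Frame.mirror_fr, Frame.flipY_fr, neg_neg, neg_neg, F₀.fr_fx_fy]; exact hg₂l
        obtain ⟨T, hT1, hT2, hT3⟩ := caseA hl hc hu hv huv F₀.flipY.mirror hd hfree' (by omega)
          (by omega) (by omega) hg (fun w hw hwd => by rw [Frame.fy_mirror]; exact hmax w hw hwd)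
        exact Or.inl ⟨T, hT1, hT2, hT3⟩
      · have hg : F₀.flipY.fr 0 d₀ ∈ l := by
          have : g₂ = F₀.flipY.fr 0 d₀ := by rw [Frame.flipY_fr, F₀.eq_fr_iff]; omega
          rw [← this]; exact hg₂l
        exact conclusion_of_frame F₀.flipY rfl (caseB hl hc hu hv huv F₀.flipY hd hfree' hg)
      · have hg : F₀.flipY.fr (F₀.fx g₂) (-F₀.fy g₂) ∈ l := by
          rw [Frame.flipY_fr, neg_neg, F₀.fr_fx_fy]; exact hg₂l
        obtain ⟨T, hT1, hT2, hT3⟩ := caseA hl hc hu hv huv F₀.flipY hd hfree' (by omega) (by omega)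
          (by omega) hg hmax
        exact Or.inl ⟨T, hT1, hT2, hT3⟩
    · -- all ordinates vanish: `g₁ = fr (±d₀) 0`, a corner of the sideways frames
      have hfy : F₀.fy g₁ = 0 := by
        have := hmin₂ g₁ hg₁; omega
      rcases le_or_gt 0 (F₀.fx g₁) with hx | hx
      · have hg : F₀.swap.fr 0 d₀ ∈ l := by
          have : g₁ = F₀.swap.fr 0 d₀ := by rw [Frame.swap_fr, F₀.eq_fr_iff]; omega
          rw [← this]; exact hg₁l
        exact conclusion_of_frame F₀.swap rfl (caseB hl hc hu hv huv F₀.swap hd hfree hg)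
      · have hg : F₀.mirror.swap.fr 0 d₀ ∈ l := by
          have : g₁ = F₀.mirror.swap.fr 0 d₀ := by
            rw [Frame.swap_fr, Frame.mirror_fr, F₀.eq_fr_iff]; omega
          rw [← this]; exact hg₁l
        exact conclusion_of_frame F₀.mirror.swap rfl (caseB hl hc hu hv huv F₀.mirror.swap hd hfree hg)

end Literature.Probability.RandomPlanarGeometry.SAW
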